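import Mathlib
import Literature.Analysis.FluidPDE.SobolevWholeSpace
import Literature.Analysis.FluidPDE.TaoEnstrophyLocalisationProofs
import Literature.Analysis.FluidPDE.LerayHopfProofs
import HarnessLib

/-!
# `RootDecompLitSlice` — slice CURRENCY BRIDGES of the mean-field one-step
# (helpers toward `CritTameScarIsCritical`, stmt-NavierStokesRegularity-31733)

Seventh helper file of the mean-field lever (cell `decomp-ns`, gen 43; companions:
`RootDecompLitSliceMeanFieldTrilinear.lean` = slice term bounds, `…MeanFieldTimeSide.lean` = time
side). The term bounds are stated in `eLpNorm` currency (`‖v − w‖₃`, `‖Dw‖₂`, `‖v‖₆`), the energy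
identity and the window dissipation in the Frobenius currency
`∫⁻ x, ENNReal.ofReal (frobeniusNormSq (fderiv ℝ v x))`, and the clock in `‖u(t) − u(T)‖₂`. This file
supplies the three conversions the assembly needs, all hypothesis-light `ℝ≥0∞` statements:

* §1 `eLpNorm_three_le` — the interpolation `‖f‖₃ ≤ ‖f‖₂^{1/2} ‖f‖₆^{1/2}` for every a.e.-strongly
  measurable `f` (Hölder on `|f|³ = (|f|²)^{3/4} (|f|⁶)^{1/4}`; no integrability hypotheses, unlike the
  integral form `integral_norm_pow_three_le_of_integrable` of `SobolevWholeSpace.lean`);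
* §2 `eLpNorm_fderiv_two_le_dissipation_sqrt`, `memLp_fderiv_two_of_dissipation_ne_top` — the operator-norm
  gradient is dominated by the dissipation: `‖Dv‖_{L²} ≤ (∫ |Dv|²_F)^{1/2}` (`‖L‖² ≤ |L|²_F`,
  `sq_opNorm_le_frobeniusNormSq`);
* §3 `eLpNorm_six_le_dissipation_sqrt`, `memLp_six_of_dissipation_ne_top` — Sobolev in dissipation
  currency on a three-dimensional space: `‖v‖₆ ≤ K (∫ |Dv|²_F)^{1/2}` for `C¹` fields `v ∈ L²`,
  `K = SNormLESNormFDerivOfEqConst` (the tree's `eLpNorm_six_le_eLpNorm_fderiv_two`).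

Everything PROVED, def-free, standard axioms.

References: L. C. Evans, *PDE* (2010), §5.6.1 Thm. 1–2, App. B.2 [Evans2010]; A. J. Majda,
A. L. Bertozzi, *Vorticity and Incompressible Flow* (2002) §1.2 [MajdaBertozzi2002].
-/

set_option linter.dupNamespace false

namespace Summit.NavierStokesRegularity.NavierStokesRegularity.Theorems

open MeasureTheory Set Filter Topology InnerProductSpace Module
open scoped RealInnerProductSpace ENNReal NNReal
open Literature.Analysis.FluidPDE

namespace MeanFieldSliceCurrency

/-! ## §1 The interpolation `‖f‖₃ ≤ ‖f‖₂^{1/2} ‖f‖₆^{1/2}` -/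

section Interpolation

variable {α : Type*} {m0 : MeasurableSpace α} {μ : Measure α}
variable {F : Type*} [NormedAddCommGroup F]

/-- **`L² ∩ L⁶ ⊂ L³`, cubed form**: `‖f‖₃³ ≤ (‖f‖₂²)^{3/4} (‖f‖₆⁶)^{1/4}` (Hölder with exponents
`4/3`, `4` on `|f|³ = |f|^{3/2} · |f|^{3/2}`; Evans, *PDE*, App. B.2). [folklore] -/
theorem eLpNorm_three_pow_le_rpow (f : α → F) (hf : AEStronglyMeasurable f μ) :
    eLpNorm f 3 μ ^ 3 ≤ (eLpNorm f 2 μ ^ 2) ^ (3 / 4 : ℝ) * (eLpNorm f 6 μ ^ 6) ^ (1 / 4 : ℝ) := by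
  have h3 := eLpNorm_natCast_pow_eq_lintegral μ f (n := 3) (by norm_num)
  have h2 := eLpNorm_natCast_pow_eq_lintegral μ f (n := 2) (by norm_num)
  have h6 := eLpNorm_natCast_pow_eq_lintegral μ f (n := 6) (by norm_num)
  simp only [Nat.cast_ofNat] at h3 h2 h6
  rw [h3, h2, h6]
  have hmeas : AEMeasurable (fun x => ‖f x‖ₑ ^ 2) μ := hf.enorm.pow_const 2
  have hmeas' : AEMeasurable (fun x => ‖f x‖ₑ ^ 6) μ := hf.enorm.pow_const 6
  have key := ENNReal.lintegral_mul_norm_pow_le hmeas hmeas' (p := 3 / 4) (q := 1 / 4)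
    (by norm_num) (by norm_num) (by norm_num)
  refine le_trans (le_of_eq (lintegral_congr fun x => ?_)) key
  rw [← ENNReal.rpow_natCast _ 2, ← ENNReal.rpow_natCast _ 6, ← ENNReal.rpow_mul,
    ← ENNReal.rpow_mul, ← ENNReal.rpow_add_of_nonneg _ _ (by norm_num) (by norm_num),
    ← ENNReal.rpow_natCast _ 3]
  norm_num

/-- **`L² ∩ L⁶ ⊂ L³`**: `‖f‖₃ ≤ ‖f‖₂^{1/2} ‖f‖₆^{1/2}` for every a.e.-strongly measurable `f`
(no integrability hypothesis: both sides may be `∞`; Evans, *PDE*, App. B.2). This converts the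
`L³` size of the fluctuation `u(t) − u(T)` into `clock^{1/2} × (L⁶ size)^{1/2}`. [folklore] -/
theorem eLpNorm_three_le (f : α → F) (hf : AEStronglyMeasurable f μ) :
    eLpNorm f 3 μ ≤ eLpNorm f 2 μ ^ (1 / 2 : ℝ) * eLpNorm f 6 μ ^ (1 / 2 : ℝ) := by
  have h := eLpNorm_three_pow_le_rpow f hf
  have h' := ENNReal.rpow_le_rpow h (by norm_num : (0 : ℝ) ≤ 1 / 3)
  rw [← ENNReal.rpow_natCast _ 3, ← ENNReal.rpow_mul] at h'
  norm_num at h'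
  refine h'.trans (le_of_eq ?_)
  rw [ENNReal.mul_rpow_of_nonneg _ _ (by norm_num : (0 : ℝ) ≤ 1 / 3), ← ENNReal.rpow_natCast _ 2,
    ← ENNReal.rpow_natCast _ 6, ← ENNReal.rpow_mul, ← ENNReal.rpow_mul, ← ENNReal.rpow_mul,
    ← ENNReal.rpow_mul]
  norm_num

end Interpolation

/-! ## §2 The operator-norm gradient is dominated by the dissipation -/

section Gradient

variable {E : Type*} [NormedAddCommGroup E] [InnerProductSpace ℝ E] [FiniteDimensional ℝ E]
  [MeasurableSpace E] (μ : Measure E)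
variable {F' : Type*} [NormedAddCommGroup F'] [InnerProductSpace ℝ F']

/-- **`‖Dv‖_{L²} ≤ (∫ |Dv|²_F)^{1/2}`** for every field `v : E → F'` (pointwise `‖L‖² ≤ |L|²_F`,
`sq_opNorm_le_frobeniusNormSq`; Majda–Bertozzi §1.2). [folklore] -/
theorem eLpNorm_fderiv_two_le_dissipation_sqrt (v : E → F') :
    eLpNorm (fderiv ℝ v) 2 μ ≤
      (∫⁻ x, ENNReal.ofReal (frobeniusNormSq (fderiv ℝ v x)) ∂μ) ^ (1 / 2 : ℝ) := by
  rw [eLpNorm_eq_lintegral_rpow_enorm_toReal two_ne_zero ENNReal.ofNat_ne_top, ENNReal.toReal_ofNat]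
  refine ENNReal.rpow_le_rpow (lintegral_mono fun x => ?_) (by norm_num)
  rw [show (2 : ℝ) = (2 : ℕ) by norm_num, ENNReal.rpow_natCast, ← ofReal_norm,
    ← ENNReal.ofReal_pow (norm_nonneg _)]
  exact ENNReal.ofReal_le_ofReal (sq_opNorm_le_frobeniusNormSq _)

variable [BorelSpace E] in
/-- **Finite dissipation puts the gradient in `L²`**: for a `C¹` field `v` with
`∫ |Dv|²_F < ∞`, `Dv ∈ L²(μ)`. [folklore] -/
theorem memLp_fderiv_two_of_dissipation_ne_top {v : E → F'} (hv : ContDiff ℝ 1 v)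
    (hD : (∫⁻ x, ENNReal.ofReal (frobeniusNormSq (fderiv ℝ v x)) ∂μ) ≠ ⊤) :
    MemLp (fderiv ℝ v) 2 μ :=
  ⟨(hv.continuous_fderiv one_ne_zero).aestronglyMeasurable,
    (eLpNorm_fderiv_two_le_dissipation_sqrt μ v).trans_lt
      (ENNReal.rpow_lt_top_of_nonneg (by norm_num) hD)⟩

end Gradient

/-! ## §3 Sobolev in dissipation currency, dimension three -/

section Sobolev

variable {E : Type*} [NormedAddCommGroup E] [InnerProductSpace ℝ E] [FiniteDimensional ℝ E]
  [MeasurableSpace E] [BorelSpace E] (μ : Measure E) [μ.IsAddHaarMeasure]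
variable {F' : Type*} [NormedAddCommGroup F'] [InnerProductSpace ℝ F'] [FiniteDimensional ℝ F']

/-- **`‖v‖_{L⁶} ≤ K (∫ |Dv|²_F)^{1/2}`** on a three-dimensional space, for `C¹` fields `v ∈ L²`,
`K = SNormLESNormFDerivOfEqConst F' μ 2` (the tree's `eLpNorm_six_le_eLpNorm_fderiv_two` + §2;
Evans, *PDE*, §5.6.1). [folklore] -/
theorem eLpNorm_six_le_dissipation_sqrt (hE : finrank ℝ E = 3) {v : E → F'} (hv : ContDiff ℝ 1 v)
    (hv2 : eLpNorm v 2 μ < ⊤) :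
    eLpNorm v 6 μ ≤ SNormLESNormFDerivOfEqConst F' μ 2 *
      (∫⁻ x, ENNReal.ofReal (frobeniusNormSq (fderiv ℝ v x)) ∂μ) ^ (1 / 2 : ℝ) :=
  (eLpNorm_six_le_eLpNorm_fderiv_two μ hE hv hv2).trans
    (mul_le_mul' le_rfl (eLpNorm_fderiv_two_le_dissipation_sqrt μ v))

/-- **Finite dissipation puts an `L²` field in `L⁶`** (dimension three): for a `C¹` field `v ∈ L²`
with `∫ |Dv|²_F < ∞`, `v ∈ L⁶(μ)`. [folklore] -/
theorem memLp_six_of_dissipation_ne_top (hE : finrank ℝ E = 3) {v : E → F'} (hv : ContDiff ℝ 1 v)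
    (hv2 : eLpNorm v 2 μ < ⊤)
    (hD : (∫⁻ x, ENNReal.ofReal (frobeniusNormSq (fderiv ℝ v x)) ∂μ) ≠ ⊤) : MemLp v 6 μ :=
  ⟨hv.continuous.aestronglyMeasurable,
    (eLpNorm_six_le_dissipation_sqrt μ hE hv hv2).trans_lt
      (ENNReal.mul_lt_top ENNReal.coe_lt_top (ENNReal.rpow_lt_top_of_nonneg (by norm_num) hD))⟩

end Sobolev

end MeanFieldSliceCurrency

end Summit.NavierStokesRegularity.NavierStokesRegularity.Theorems
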